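import Summits.Ventures.CertifiedManyBodySolver.Downfold.BoxesLa214V115M2cPhaseSeparationGrandCanonicalThermalGap
import Summits.Ventures.CertifiedManyBodySolver.Certificates.HubbardSquare_n7o8_tpm1o4_thermal_C1nodesTT_3x2_stair221_j300793
import Literature.MathematicalPhysics.QuantumLattice.HubbardTTPrimeThermalPressureParticleHole
import Literature.MathematicalPhysics.QuantumLattice.HubbardTTPrimeThermalPressureCellRule
import Literature.MathematicalPhysics.QuantumLattice.MarkovCertificatePressureCeiling
import HarnessLib

/-!
# Ventures/CertifiedManyBodySolver — Downfold/BoxesLa214V115M2cPhaseSeparationThermalCuprateAnchor.lean: the LSCO `x = 1/8` box's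
# competing-orders cells at `T > 0`, RE-ANCHORED on the first genuine `t–t′` Markov (C1) certificates at the CUPRATE POINT `(8, 7/8, −1/4)`
# (hubbard-thermal-eng-4, kit j300793) — on `t′/t ∈ [−1/4, −1/5] × U/t ∈ [8, 81/10]` the `(≤ 1/5 | ≥ 1)` thermal coexistence is excluded
# for every `β ≥ 12` (was `21`), the `(≤ 1/4 | ≥ 1)` one for every `β ≥ 21` (was `41`); μ-axis gap `Δμ ≥ t/10 ∀ β ≥ 16` (was `30`)

HONEST FRAMING: first certified bounds; not a superconductivity verdict. CLASS = DERIVED / CONTEXT on a SCREENING-GRADE material box —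
CONTROL class (the excluded partner phase is DILUTE, density `≤ 1/5` resp. `≤ 1/4`, hole doping `≥ 80 %` / `≥ 75 %`); conditional BY NAME on
exactly the claim nodes of the parents (`Downfold/BoxesLa214V115M2cPhaseSeparationThermalHotAnchor.lean`, g20; `…GrandCanonicalThermalGap.lean`,
g23): VARBOX plane `cert_obx32x4tpm1o4D1200_openbox_32x4_N112_planes`, K2DIAG-A bootstrap `cert_laBoxE_K2diag_GU8n1tpm3o10_j299783_up`,
registry #472 · #428, the kernel Fermi-sea tangent rows and the dilute entropy caps `2H_b(1/10) ≤ 0.666`, `2H_b(1/8) ≤ 0.77` — AND on ONE of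
hubbard-thermal-eng-4's six genuine `t–t′` Markov (C1) claim nodes at the cuprate point, `cert_feC1tt_stair221_tpm1o4_b2_j300793` (7-site
staircase, `β_h·t = 2`; `Certificates/HubbardSquare_n7o8_tpm1o4_thermal_C1nodesTT_3x2_stair221_j300793.lean`, p662054; producer-certified in
arb ball arithmetic + replayed in-job; referee legs hub-tc-therm-ref-2 S2379 / hubbard-tc-ref §462 R459 CLEAN). Statements about canonical
thermal torus-limit states (sector Gibbs states) and translation-invariant variational equilibria of `H(1,s,U) − μN` (existence not claimed,
not needed); nothing about stripes, about coexistence with phases of hole doping `< 75 %`, about which phase is realised, about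
superconductivity or `T_c`; nothing about La₁.₈₇₅Sr₀.₁₂₅CuO₄ itself; no number of record. Zero compute, no definition, no `sorry`.

Cell `pub/hubbard-downfold` (MO-S1 ↔ S2 seam «box ↦ one word»; D-0096 (ii)/(iii), the `T` axis of the D-0098 map), seat `hubbard-downfold-unc-2`
(`prover-hubbard-downfold-unc-2-g24-0`; filling direction: ONE grand-canonical anchor caps the canonical pressure at EVERY density — the
anchors tuned at `n = 7/8` are READ AT `n = 1`).

THE DEVICE (§0, generic): at HALF FILLING the canonical pressure `p(β; t, t′, U; 1)` is EVEN in `t′` (`pressureTT'_halfFilling_neg_tPrime`,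
particle–hole) and CONVEX in `t′` (`pressureTT'_le_convexComb_tPrime`), and antitone in `U` (`pressureTT'_anti_U`): hence ONE anchor
`p(β_h; t, s₀, U₀; 1) ≤ Π` caps the whole BAND `|t′| ≤ |s₀| × U ≥ U₀` (`pressureTT'_halfFilling_le_on_band_of_anchor`; the reflected corner
`−s₀` carries the same value, then the corner rule `pressureTT'_le_on_cell_of_lowerU_corners`). Read at `n = 1`, the staircase anchors give
`p(β_h; 1, s, U; 1) ≤ Π(β_h) = m − β_h·μ` on `|s| ≤ 1/4 × U ≥ 8`: `Π(2) = 3994878420865131/2⁵¹ ≈ 1.7740824`, `Π(3/2) = 3290211915065077/2⁵¹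
≈ 1.4611476`, `Π(1) = 2691252827637373/2⁵¹ ≈ 1.1951563`; the parents' `(−5/16, 15/2)` corner anchor `Π = 5523207596574253/2⁵² ≈ 1.2263984`
(`β_h = 3/4`, kit j290715) likewise caps the band `|s| ≤ 5/16 × U ≥ 15/2` from ONE corner (`lsco_hotCap_n1_b3o4_j290715_on_band`).
WHAT CHANGES (threshold `β₀ = [aπ₁ + bΠ + β_h·b·L₈(s)]/M(s, U)`, exact scan `gen-g24/g24scan.py`): the `n = 1` anchor TERM `Π + β_h·L₈(s)` drops
from `0.751` (`β_h = 3/4`) to `0.5056` at `s = −1/4` / `0.5376` at `s = −1/5` (`β_h = 2`); on the sub-cell `t′ ∈ [−1/4, −1/5] × U ∈ [8, 81/10]`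
(far-end margins `M ≥ 0.0448` / `0.0272`):
* §1 `lsco78_not_thermal_mix_le_1o5_ge_one_beta12_tpm1o4_1o5` — `(≤ 1/5 | ≥ 1)` EXCLUDED for every `β ≥ 12` (`β₀ = 11.83`; parent `β ≥ 21`, and
  `16.44` with the parents' anchor on this very sub-cell) — `T ≲ 329–387 K` on the box's `t ∈ [0.34, 0.40]` eV [float]; on `U ∈ [8, 83/10]` every
  `β ≥ 14` (`β₀ = 14.00`, far-end margin `0.0379`);
* §2 `lsco78_not_thermal_mix_le_1o4_ge_one_beta21_tpm1o4_1o5` — `(≤ 1/4 | ≥ 1)` for every `β ≥ 21` (`β₀ = 20.17`; parent `β ≥ 41`) — `T ≲ 188–221 K`;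
* §3 the μ AXIS at `T > 0` (law `psGCT_gap_above_column_hotAnchor`, g23): no `μ` carries both a `≤ 1/5`-filled and a `≥ 1`-filled equilibrium
  state for any `β ≥ 12`; `Δμ ≥ t/10` for every `β ≥ 16` (`β₀ = 15.47`; parent `30`), `Δμ ≥ t/5` for every `β ≥ 23` (`22.34`), `Δμ ≥ t/4` for
  every `β ≥ 29` (`28.71`; `T = 0` limit `33/100`).
The left `t′`-half `[−3/10, −1/4]` keeps the parents' thresholds (`|s| > 1/4` there; no `t′`-chord between anchors at different `β_h`); when
n = 1-tuned corner anchors at `β_h ∈ {3/2, 2}` land (hubbard-thermal-eng-4 PREREG j318145 / j318146), equal-`β_h` `t′`-chords with the cuprate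
anchor re-price the whole cell. READING (D-0098 `T`-axis cell annotation, CONTROL): «LSCO x = 1/8 one-band box, t′/t ∈ [−0.25, −0.20] ×
U/t ∈ [8.0, 8.1]: at T ≲ 330 K no macroscopic phase separation of the thermal state into the half-filled (or denser) phase and a phase of
hole doping ≥ 80 %; at T ≲ 190 K none with a phase of hole doping ≥ 75 %; Δμ ≥ 35 meV between the two at T ≲ 250 K».
WHAT THIS IS NOT: a certificate; a statement at other `U`, `t′` or `β`, or about La₁.₈₇₅Sr₀.₁₂₅CuO₄; a stripe / superconductivity / `T_c`
sentence; the anchors are PRODUCER-CERTIFIED claim nodes (arb in-job verification; custody in their node files).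
References: R. B. Israel, *Convexity in the Theory of Lattice Gases* (1979) Thm I.2.4 / I.3.4 [Israel1979]; D. Poulin, M. B. Hastings,
PRL 106 (2011) 080403 [PoulinHastings2011]; E. H. Lieb, F. Y. Wu, Physica A 321 (2003) 1 [LiebWuPhysicaA2003]; D. Ruelle, *Statistical
Mechanics* (1969) §3.3 [Ruelle1969]; V. J. Emery, S. A. Kivelson, H. Q. Lin, PRL 64 (1990) 475 [EmeryKivelsonLin1990].
-/

noncomputable section

namespace Summit.Ventures.CertifiedManyBodySolver.Downfold

open Summit.Ventures.CertifiedManyBodySolver.Observables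
open Summit.Ventures.CertifiedManyBodySolver.Certificates
open Literature.MathematicalPhysics.QuantumLattice Literature.MathematicalPhysics.QuantumLattice.ThermodynamicLimit
open Literature.MathematicalPhysics.QuantumLattice.InfVolFermionState Set Filter

/-! ## §0 The band device at half filling, and the cuprate-point anchors READ AT `n = 1` -/

/-- **ONE ANCHOR CAPS A `t′`-BAND AT HALF FILLING** (generic; `β_h ≥ 0`, `U₀ ≥ 0`): if `p(β_h; t, s₀, U₀; 1) ≤ V` then
`p(β_h; t, s, U; 1) ≤ V` for every `s ∈ [s₁, s₂] ⊆ [s₀, −s₀]` and every `U ∈ [U₁, U₂]` with `U₁ ≥ U₀` — the pressure at density `1` is even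
in `t′` (particle–hole), so the reflected corner `−s₀` carries the same ceiling, convex in `t′` and antitone in `U` (corner rule on the lower
`U`-face). [cite: LiebWuPhysicaA2003, §1 eq. (3)] [cite: Israel1979, Thm. I.3.4] -/
theorem pressureTT'_halfFilling_le_on_band_of_anchor {βh : ℝ} (hβh : 0 ≤ βh) (t : ℝ) {s₀ U₀ : ℝ} (hU₀ : 0 ≤ U₀) {V : ℝ}
    (hA : pressureTT' βh t s₀ U₀ 1 ≤ V) {s₁ s₂ U₁ U₂ : ℝ} (hs₁ : s₀ ≤ s₁) (hs₂ : s₂ ≤ -s₀) (hU₁ : U₀ ≤ U₁) :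
    ∀ s ∈ Icc s₁ s₂, ∀ U ∈ Icc U₁ U₂, pressureTT' βh t s U 1 ≤ V := by
  intro s hs U hU
  have hcell := pressureTT'_le_on_cell_of_lowerU_corners (n := 1) (by norm_num) (by norm_num) (β₁ := βh) (β₂ := βh)
    (s₁ := s₀) (s₂ := -s₀) (U₁ := U₀) (U₂ := U) hβh hU₀ t (V := V) ?_
  · exact hcell βh ⟨le_rfl, le_rfl⟩ s ⟨hs₁.trans hs.1, hs.2.trans hs₂⟩ U ⟨hU₁.trans hU.1, le_rfl⟩
  intro b hb s' hs'
  have hb' : b = βh := by simpa using hb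
  subst hb'
  rcases (show s' = s₀ ∨ s' = -s₀ by simpa using hs') with h | h <;> subst h
  · exact hA
  · rw [pressureTT'_halfFilling_neg_tPrime hβh t (-s₀) hU₀, neg_neg]; exact hA

/-- **The parents' corner anchor `(t′, U) = (−5/16, 15/2)`, `β_h = 3/4` (kit j290715) caps the BAND `|s| ≤ 5/16 × U ≥ 15/2` at `n = 1`**:
`p(3/4; 1, s, U; 1) ≤ 5523207596574253/2⁵²` for `[s₁, s₂] ⊆ [−5/16, 5/16]`, `U₁ ≥ 15/2` (one corner suffices — cf. the parents'
two-corner `lsco_hotCap_n1_b3o4_on_cell` on `[−5/16, −3/16]`). [cite: PoulinHastings2011, eqs. (3)–(8)] [cite: Israel1979, Thm. I.3.4] -/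
theorem lsco_hotCap_n1_b3o4_j290715_on_band (hLL : cert_feC1tt_3x2_tpm5o16_U15o2_b3o4_j290715) {s₁ s₂ U₁ U₂ : ℝ}
    (hs₁ : -5 / 16 ≤ s₁) (hs₂ : s₂ ≤ 5 / 16) (hU₁ : 15 / 2 ≤ U₁) :
    ∀ s ∈ Icc s₁ s₂, ∀ U ∈ Icc U₁ U₂, pressureTT' (3 / 4 : ℝ) 1 s U 1 ≤ (5523207596574253 / 4503599627370496 : ℝ) :=
  pressureTT'_halfFilling_le_on_band_of_anchor (by norm_num) 1 (by norm_num) (lsco_hotCap_n1_tpm5o16_U15o2_b3o4_j290715 hLL)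
    hs₁ (hs₂.trans_eq (by norm_num)) hU₁

/-- **Cuprate-point anchor, 7-site staircase, `β_h = 2` (kit j300793) READ AT HALF FILLING**: `p(2; 1, −1/4, 8; 1) ≤ m − 2·μ =
3994878420865131/2⁵¹` (≈ 1.7740824014; the node's `(m, μ)` read through `pressureTT'_le_of_stairMarkovCertificateTT'` at density `1`).
[cite: PoulinHastings2011, eqs. (3)–(8)] [cite: Israel1979, Thm. I.2.4] -/
theorem lsco_hotCap_n1_tpm1o4_U8_b2_stair_j300793 (hC1 : cert_feC1tt_stair221_tpm1o4_b2_j300793) :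
    pressureTT' (2 : ℝ) 1 (-1 / 4 : ℝ) (8 : ℝ) 1 ≤ (3994878420865131 / 2251799813685248 : ℝ) := by
  obtain ⟨k, S, hS, z, hz, O, hO, g, LB, hLB, hcert⟩ := hC1
  have h := pressureTT'_le_of_stairMarkovCertificateTT' (t := 1) (U := 8) (n := 1) (by norm_num) (by norm_num) (by norm_num)
    (βh := (2 : ℝ)) (by norm_num) (7444112551679893 / 4503599627370496 : ℝ) (lo₁ := 0) (hi₁ := 3) (lo₀ := 0) (hi₀ := 4)
    (by norm_num) (by norm_num) (by norm_num)
    Finset.univ S hS z hz (fun i _ => hO i) g hLB hcert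
  refine h.trans (le_of_eq ?_)
  norm_num

/-- **The cuprate-point anchor (`β_h = 2`) caps the BAND `|s| ≤ 1/4 × U ≥ 8` at `n = 1`**: `p(2; 1, s, U; 1) ≤ 3994878420865131/2⁵¹`
for `[s₁, s₂] ⊆ [−1/4, 1/4]`, `U₁ ≥ 8` (any `U₂`). [cite: PoulinHastings2011, eqs. (3)–(8)] [cite: Israel1979, Thm. I.3.4] -/
theorem lsco_hotCap_n1_b2_j300793_on_cell (hC1 : cert_feC1tt_stair221_tpm1o4_b2_j300793) {s₁ s₂ U₁ U₂ : ℝ}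
    (hs₁ : -1 / 4 ≤ s₁) (hs₂ : s₂ ≤ 1 / 4) (hU₁ : 8 ≤ U₁) :
    ∀ s ∈ Icc s₁ s₂, ∀ U ∈ Icc U₁ U₂, pressureTT' (2 : ℝ) 1 s U 1 ≤ (3994878420865131 / 2251799813685248 : ℝ) :=
  pressureTT'_halfFilling_le_on_band_of_anchor (by norm_num) 1 (by norm_num) (lsco_hotCap_n1_tpm1o4_U8_b2_stair_j300793 hC1)
    hs₁ (hs₂.trans_eq (by norm_num)) hU₁

/-- **Cuprate-point anchor, 7-site staircase, `β_h = 3 / 2` (kit j300793) READ AT HALF FILLING**: `p(3 / 2; 1, −1/4, 8; 1) ≤ m − 3 / 2·μ =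
3290211915065077/2⁵¹` (≈ 1.4611476096; the node's `(m, μ)` read through `pressureTT'_le_of_stairMarkovCertificateTT'` at density `1`).
[cite: PoulinHastings2011, eqs. (3)–(8)] [cite: Israel1979, Thm. I.2.4] -/
theorem lsco_hotCap_n1_tpm1o4_U8_b3o2_stair_j300793 (hC1 : cert_feC1tt_stair221_tpm1o4_b3o2_j300793) :
    pressureTT' (3 / 2 : ℝ) 1 (-1 / 4 : ℝ) (8 : ℝ) 1 ≤ (3290211915065077 / 2251799813685248 : ℝ) := by
  obtain ⟨k, S, hS, z, hz, O, hO, g, LB, hLB, hcert⟩ := hC1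
  have h := pressureTT'_le_of_stairMarkovCertificateTT' (t := 1) (U := 8) (n := 1) (by norm_num) (by norm_num) (by norm_num)
    (βh := (3 / 2 : ℝ)) (by norm_num) (1944155336646745 / 1125899906842624 : ℝ) (lo₁ := 0) (hi₁ := 3) (lo₀ := 0) (hi₀ := 4)
    (by norm_num) (by norm_num) (by norm_num)
    Finset.univ S hS z hz (fun i _ => hO i) g hLB hcert
  refine h.trans (le_of_eq ?_)
  norm_num

/-- **The cuprate-point anchor (`β_h = 3 / 2`) caps the BAND `|s| ≤ 1/4 × U ≥ 8` at `n = 1`**: `p(3 / 2; 1, s, U; 1) ≤ 3290211915065077/2⁵¹`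
for `[s₁, s₂] ⊆ [−1/4, 1/4]`, `U₁ ≥ 8` (any `U₂`). [cite: PoulinHastings2011, eqs. (3)–(8)] [cite: Israel1979, Thm. I.3.4] -/
theorem lsco_hotCap_n1_b3o2_j300793_on_cell (hC1 : cert_feC1tt_stair221_tpm1o4_b3o2_j300793) {s₁ s₂ U₁ U₂ : ℝ}
    (hs₁ : -1 / 4 ≤ s₁) (hs₂ : s₂ ≤ 1 / 4) (hU₁ : 8 ≤ U₁) :
    ∀ s ∈ Icc s₁ s₂, ∀ U ∈ Icc U₁ U₂, pressureTT' (3 / 2 : ℝ) 1 s U 1 ≤ (3290211915065077 / 2251799813685248 : ℝ) :=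
  pressureTT'_halfFilling_le_on_band_of_anchor (by norm_num) 1 (by norm_num) (lsco_hotCap_n1_tpm1o4_U8_b3o2_stair_j300793 hC1)
    hs₁ (hs₂.trans_eq (by norm_num)) hU₁

/-- **Cuprate-point anchor, 7-site staircase, `β_h = 1` (kit j300793) READ AT HALF FILLING**: `p(1; 1, −1/4, 8; 1) ≤ m − 1·μ =
2691252827637373/2⁵¹` (≈ 1.1951563417; the node's `(m, μ)` read through `pressureTT'_le_of_stairMarkovCertificateTT'` at density `1`).
[cite: PoulinHastings2011, eqs. (3)–(8)] [cite: Israel1979, Thm. I.2.4] -/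
theorem lsco_hotCap_n1_tpm1o4_U8_b1_stair_j300793 (hC1 : cert_feC1tt_stair221_tpm1o4_b1_j300793) :
    pressureTT' (1 : ℝ) 1 (-1 / 4 : ℝ) (8 : ℝ) 1 ≤ (2691252827637373 / 2251799813685248 : ℝ) := by
  obtain ⟨k, S, hS, z, hz, O, hO, g, LB, hLB, hcert⟩ := hC1
  have h := pressureTT'_le_of_stairMarkovCertificateTT' (t := 1) (U := 8) (n := 1) (by norm_num) (by norm_num) (by norm_num)
    (βh := (1 : ℝ)) (by norm_num) (4198904021506435 / 2251799813685248 : ℝ) (lo₁ := 0) (hi₁ := 3) (lo₀ := 0) (hi₀ := 4)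
    (by norm_num) (by norm_num) (by norm_num)
    Finset.univ S hS z hz (fun i _ => hO i) g hLB hcert
  refine h.trans (le_of_eq ?_)
  norm_num

/-- **The cuprate-point anchor (`β_h = 1`) caps the BAND `|s| ≤ 1/4 × U ≥ 8` at `n = 1`**: `p(1; 1, s, U; 1) ≤ 2691252827637373/2⁵¹`
for `[s₁, s₂] ⊆ [−1/4, 1/4]`, `U₁ ≥ 8` (any `U₂`). [cite: PoulinHastings2011, eqs. (3)–(8)] [cite: Israel1979, Thm. I.3.4] -/
theorem lsco_hotCap_n1_b1_j300793_on_cell (hC1 : cert_feC1tt_stair221_tpm1o4_b1_j300793) {s₁ s₂ U₁ U₂ : ℝ}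
    (hs₁ : -1 / 4 ≤ s₁) (hs₂ : s₂ ≤ 1 / 4) (hU₁ : 8 ≤ U₁) :
    ∀ s ∈ Icc s₁ s₂, ∀ U ∈ Icc U₁ U₂, pressureTT' (1 : ℝ) 1 s U 1 ≤ (2691252827637373 / 2251799813685248 : ℝ) :=
  pressureTT'_halfFilling_le_on_band_of_anchor (by norm_num) 1 (by norm_num) (lsco_hotCap_n1_tpm1o4_U8_b1_stair_j300793 hC1)
    hs₁ (hs₂.trans_eq (by norm_num)) hU₁

/-! ## §1 `(≤ 1/5 | ≥ 1)` coexistence EXCLUDED in thermal states on `t′ ∈ [−1/4, −1/5] × U ∈ [8, 81/10]`, every `β ≥ 12` (and on `U ∈ [8, 83/10]`, every `β ≥ 14`) -/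

/-- **THE RE-ANCHORED THERMAL `(≤ 1/5 | ≥ 1)` SENTENCE on `t′ ∈ [−1/4, −1/5] × U ∈ [8, 81/10]`, every `β ≥ 12`** (`β₀ = 11.83`; cuprate-point staircase anchor `β_h = 2` read at `n = 1`; parents: `β ≥ 21` on the whole cell, `16.44` with their anchor here): for every `(s, U)` of the sub-cell and every canonical thermal torus-limit state of the `t–t′` model at `(β; 1, s, U; n)` (any `0 < n < 2`), the state is NOT a macroscopic mixture of a translation-invariant phase of density `0 < ρ(ω₁) ≤ 1/5` and one of density `1 ≤ ρ(ω₂) < 2`. [cite: Israel1979, Thm. I.2.4] [cite: EmeryKivelsonLin1990, pp. 475–476] [cite: PoulinHastings2011, eqs. (3)–(8)] [cite: Griffiths1966, §II] -/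
theorem lsco78_not_thermal_mix_le_1o5_ge_one_beta12_tpm1o4_1o5 (hVB : cert_obx32x4tpm1o4D1200_openbox_32x4_N112_planes)
    (hK8 : cert_laBoxE_K2diag_GU8n1tpm3o10_j299783_up)
    (h472 : cert_r472_pb2_tl_upper_n1_U8) (h428 : cert_r428_hubSQ_hanK7R6_U8_r5_e4_so4blk)
    (hC1 : cert_feC1tt_stair221_tpm1o4_b2_j300793)
    {s : ℝ} (hs : s ∈ Icc (-1 / 4 : ℝ) (-1 / 5)) {U : ℝ} (hU : U ∈ Icc (8 : ℝ) (81 / 10))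
    {β : ℝ} (hβ : (12 : ℝ) ≤ β)
    {ω₁ ω₂ : InfVolFermionState 2} (h₁ : ω₁.IsTranslationInvariant) (h₂ : ω₂.IsTranslationInvariant)
    (hρ₁ : 0 < ω₁.density) (hρ₁' : ω₁.density ≤ 1 / 5) (hρ₂ : 1 ≤ ω₂.density) (hρ₂' : ω₂.density < 2)
    {n : ℝ} (hn0 : 0 < n) (hn2 : n < 2) {lam : ℝ} (hl0 : 0 < lam) (hl1 : lam < 1) {Ls : ℕ → ℕ}
    (hLs : Tendsto Ls atTop atTop) :
    ¬ (mix lam hl0.le hl1.le ω₁ ω₂).IsTorusLimitOfMixture (sectorGibbsCount n) (fun L => sectorGibbsWeightTT' β 1 s U n L)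
      (fun L => sectorGibbsVectorTT' 1 s U n L) Ls := by
  refine psT_not_thermal_mix_above_column_hotAnchor 1 (s₁ := -1 / 4) (s₂ := -1 / 5) (U₂ := 8) (U₃ := 81 / 10)
    (n₁ := 1 / 5) (n₂ := 1) (a := 5 / 32) (b := 27 / 32) (β₀ := 12) (βh₁ := 0) (βh₂ := 2)
    (π₁ := 0.666) (π₂ := 3994878420865131 / 2251799813685248)
    (by norm_num) (by norm_num) (by norm_num) (by norm_num) (by norm_num) (by norm_num) (by norm_num) (by norm_num)
    (by norm_num) (by norm_num) (by norm_num) (by norm_num) hβ (by norm_num)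
    (lsco78_capPlane_on_cell_of hVB (by norm_num) (by norm_num) (by norm_num))
    (fun s hs => lsco_n1_law8_of hK8 h472 h428 s ⟨hs.1.trans' (by norm_num), hs.2.trans (by norm_num)⟩)
    (fun s hs U hU => lsco_dilute14_floor_right (n₁ := 1 / 5) (by norm_num) (by norm_num) s hs U (by linarith [hU.1]))
    (lsco_diluteCap_1o5 (by norm_num))
    (lsco_hotCap_n1_b2_j300793_on_cell hC1 (by norm_num) (by norm_num) (by norm_num))
    ?_ ?_ hs hU h₁ h₂ hρ₁ hρ₁' hρ₂ hρ₂' hn0 hn2 hl0 hl1 hLs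
  · intro s hs; obtain ⟨h1, h2⟩ := hs; push_cast; norm_num; nlinarith [h1, h2]
  · intro s hs; obtain ⟨h1, h2⟩ := hs; push_cast; norm_num; nlinarith [h1, h2]

/-- **`(≤ 1/5 | ≥ 1)` on the wider column `t′ ∈ [−1/4, −1/5] × U ∈ [8, 83/10]`, every `β ≥ 14`** (`β₀ = 14.00`; far-end `T = 0` margin `0.0379`). [cite: Israel1979, Thm. I.2.4] [cite: Griffiths1966, §II] [cite: PoulinHastings2011, eqs. (3)–(8)] -/
theorem lsco78_not_thermal_mix_le_1o5_ge_one_beta14_tpm1o4_1o5_U83o10 (hVB : cert_obx32x4tpm1o4D1200_openbox_32x4_N112_planes)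
    (hK8 : cert_laBoxE_K2diag_GU8n1tpm3o10_j299783_up)
    (h472 : cert_r472_pb2_tl_upper_n1_U8) (h428 : cert_r428_hubSQ_hanK7R6_U8_r5_e4_so4blk)
    (hC1 : cert_feC1tt_stair221_tpm1o4_b2_j300793)
    {s : ℝ} (hs : s ∈ Icc (-1 / 4 : ℝ) (-1 / 5)) {U : ℝ} (hU : U ∈ Icc (8 : ℝ) (83 / 10))
    {β : ℝ} (hβ : (14 : ℝ) ≤ β)
    {ω₁ ω₂ : InfVolFermionState 2} (h₁ : ω₁.IsTranslationInvariant) (h₂ : ω₂.IsTranslationInvariant)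
    (hρ₁ : 0 < ω₁.density) (hρ₁' : ω₁.density ≤ 1 / 5) (hρ₂ : 1 ≤ ω₂.density) (hρ₂' : ω₂.density < 2)
    {n : ℝ} (hn0 : 0 < n) (hn2 : n < 2) {lam : ℝ} (hl0 : 0 < lam) (hl1 : lam < 1) {Ls : ℕ → ℕ}
    (hLs : Tendsto Ls atTop atTop) :
    ¬ (mix lam hl0.le hl1.le ω₁ ω₂).IsTorusLimitOfMixture (sectorGibbsCount n) (fun L => sectorGibbsWeightTT' β 1 s U n L)
      (fun L => sectorGibbsVectorTT' 1 s U n L) Ls := by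
  refine psT_not_thermal_mix_above_column_hotAnchor 1 (s₁ := -1 / 4) (s₂ := -1 / 5) (U₂ := 8) (U₃ := 83 / 10)
    (n₁ := 1 / 5) (n₂ := 1) (a := 5 / 32) (b := 27 / 32) (β₀ := 14) (βh₁ := 0) (βh₂ := 2)
    (π₁ := 0.666) (π₂ := 3994878420865131 / 2251799813685248)
    (by norm_num) (by norm_num) (by norm_num) (by norm_num) (by norm_num) (by norm_num) (by norm_num) (by norm_num)
    (by norm_num) (by norm_num) (by norm_num) (by norm_num) hβ (by norm_num)
    (lsco78_capPlane_on_cell_of hVB (by norm_num) (by norm_num) (by norm_num))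
    (fun s hs => lsco_n1_law8_of hK8 h472 h428 s ⟨hs.1.trans' (by norm_num), hs.2.trans (by norm_num)⟩)
    (fun s hs U hU => lsco_dilute14_floor_right (n₁ := 1 / 5) (by norm_num) (by norm_num) s hs U (by linarith [hU.1]))
    (lsco_diluteCap_1o5 (by norm_num))
    (lsco_hotCap_n1_b2_j300793_on_cell hC1 (by norm_num) (by norm_num) (by norm_num))
    ?_ ?_ hs hU h₁ h₂ hρ₁ hρ₁' hρ₂ hρ₂' hn0 hn2 hl0 hl1 hLs
  · intro s hs; obtain ⟨h1, h2⟩ := hs; push_cast; norm_num; nlinarith [h1, h2]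
  · intro s hs; obtain ⟨h1, h2⟩ := hs; push_cast; norm_num; nlinarith [h1, h2]

/-! ## §2 `(≤ 1/4 | ≥ 1)` coexistence EXCLUDED in thermal states on `t′ ∈ [−1/4, −1/5] × U ∈ [8, 81/10]`, every `β ≥ 21` -/

/-- **THE RE-ANCHORED THERMAL `(≤ 1/4 | ≥ 1)` SENTENCE on `t′ ∈ [−1/4, −1/5] × U ∈ [8, 81/10]`, every `β ≥ 21`** (`β₀ = 20.17`; dilute entropy cap `2H_b(1/8) ≤ 0.77`, rows touching at `1/4`; parents: `β ≥ 41`): no canonical thermal torus-limit state at `(β; 1, s, U; n)` is a macroscopic mixture of translation-invariant phases of densities `0 < ρ(ω₁) ≤ 1/4` and `1 ≤ ρ(ω₂) < 2`. [cite: Israel1979, Thm. I.2.4] [cite: EmeryKivelsonLin1990, pp. 475–476] [cite: PoulinHastings2011, eqs. (3)–(8)] [cite: Griffiths1966, §II] -/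
theorem lsco78_not_thermal_mix_le_1o4_ge_one_beta21_tpm1o4_1o5 (hVB : cert_obx32x4tpm1o4D1200_openbox_32x4_N112_planes)
    (hK8 : cert_laBoxE_K2diag_GU8n1tpm3o10_j299783_up)
    (h472 : cert_r472_pb2_tl_upper_n1_U8) (h428 : cert_r428_hubSQ_hanK7R6_U8_r5_e4_so4blk)
    (hC1 : cert_feC1tt_stair221_tpm1o4_b2_j300793)
    {s : ℝ} (hs : s ∈ Icc (-1 / 4 : ℝ) (-1 / 5)) {U : ℝ} (hU : U ∈ Icc (8 : ℝ) (81 / 10))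
    {β : ℝ} (hβ : (21 : ℝ) ≤ β)
    {ω₁ ω₂ : InfVolFermionState 2} (h₁ : ω₁.IsTranslationInvariant) (h₂ : ω₂.IsTranslationInvariant)
    (hρ₁ : 0 < ω₁.density) (hρ₁' : ω₁.density ≤ 1 / 4) (hρ₂ : 1 ≤ ω₂.density) (hρ₂' : ω₂.density < 2)
    {n : ℝ} (hn0 : 0 < n) (hn2 : n < 2) {lam : ℝ} (hl0 : 0 < lam) (hl1 : lam < 1) {Ls : ℕ → ℕ}
    (hLs : Tendsto Ls atTop atTop) :
    ¬ (mix lam hl0.le hl1.le ω₁ ω₂).IsTorusLimitOfMixture (sectorGibbsCount n) (fun L => sectorGibbsWeightTT' β 1 s U n L)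
      (fun L => sectorGibbsVectorTT' 1 s U n L) Ls := by
  refine psT_not_thermal_mix_above_column_hotAnchor 1 (s₁ := -1 / 4) (s₂ := -1 / 5) (U₂ := 8) (U₃ := 81 / 10)
    (n₁ := 1 / 4) (n₂ := 1) (a := 1 / 6) (b := 5 / 6) (β₀ := 21) (βh₁ := 0) (βh₂ := 2)
    (π₁ := 0.77) (π₂ := 3994878420865131 / 2251799813685248)
    (by norm_num) (by norm_num) (by norm_num) (by norm_num) (by norm_num) (by norm_num) (by norm_num) (by norm_num)
    (by norm_num) (by norm_num) (by norm_num) (by norm_num) hβ (by norm_num)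
    (lsco78_capPlane_on_cell_of hVB (by norm_num) (by norm_num) (by norm_num))
    (fun s hs => lsco_n1_law8_of hK8 h472 h428 s ⟨hs.1.trans' (by norm_num), hs.2.trans (by norm_num)⟩)
    (fun s hs U hU => lsco_dilute14_floor_right (n₁ := 1 / 4) (by norm_num) (by norm_num) s hs U (by linarith [hU.1]))
    (lsco_diluteCap_1o4 (by norm_num))
    (lsco_hotCap_n1_b2_j300793_on_cell hC1 (by norm_num) (by norm_num) (by norm_num))
    ?_ ?_ hs hU h₁ h₂ hρ₁ hρ₁' hρ₂ hρ₂' hn0 hn2 hl0 hl1 hLs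
  · intro s hs; obtain ⟨h1, h2⟩ := hs; push_cast; norm_num; nlinarith [h1, h2]
  · intro s hs; obtain ⟨h1, h2⟩ := hs; push_cast; norm_num; nlinarith [h1, h2]

/-! ## §3 The μ axis at `T > 0` on `t′ ∈ [−1/4, −1/5] × U ∈ [8, 81/10]`: one-`μ` exclusion for every `β ≥ 12`; `Δμ ≥ t/10 ∀ β ≥ 16`, `≥ t/5 ∀ β ≥ 23`, `≥ t/4 ∀ β ≥ 29` -/

/-- **ONE-`μ` EXCLUSION AT `T > 0`, every `β ≥ 12`** on `t′ ∈ [−1/4, −1/5] × U ∈ [8, 81/10]` (parents: `β ≥ 21`): if a translation-invariant variational equilibrium state of `H(1,s,U) − μN` at inverse temperature `β` has density `≤ 1/5`, then NO equilibrium state at the same `(β, μ)` has density `≥ 1` — the density `n(μ)` does not jump across `[1/5, 1]`. [cite: Israel1979, Thm. I.2.4] [cite: Griffiths1966, §II] [cite: PoulinHastings2011, eqs. (3)–(8)] -/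
theorem lsco78_not_equilibrium_ge_one_of_equilibrium_le_1o5_beta12_tpm1o4_1o5 (hVB : cert_obx32x4tpm1o4D1200_openbox_32x4_N112_planes)
    (hK8 : cert_laBoxE_K2diag_GU8n1tpm3o10_j299783_up)
    (h472 : cert_r472_pb2_tl_upper_n1_U8) (h428 : cert_r428_hubSQ_hanK7R6_U8_r5_e4_so4blk)
    (hC1 : cert_feC1tt_stair221_tpm1o4_b2_j300793)
    {s : ℝ} (hs : s ∈ Icc (-1 / 4 : ℝ) (-1 / 5)) {U : ℝ} (hU : U ∈ Icc (8 : ℝ) (81 / 10))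
    {β : ℝ} (hβ : (12 : ℝ) ≤ β) {μ : ℝ} {ω₁ ω₂ : InfVolFermionState 2}
    (hω₁ : ω₁.IsVarEquilibrium β (gcInteractionTT' 1 s U μ 0) 1) (hρ₁ : ω₁.density ≤ 1 / 5) (hρ₂ : 1 ≤ ω₂.density) :
    ¬ ω₂.IsVarEquilibrium β (gcInteractionTT' 1 s U μ 0) 1 := by
  refine psGCT_not_equilibrium_above_column_hotAnchor 1 (s₁ := -1 / 4) (s₂ := -1 / 5) (U₂ := 8) (U₃ := 81 / 10)
    (n₁ := 1 / 5) (n₂ := 1) (a := 5 / 32) (b := 27 / 32) (β₀ := 12) (βh₁ := 0) (βh₂ := 2)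
    (π₁ := 0.666) (π₂ := 3994878420865131 / 2251799813685248)
    (by norm_num) (by norm_num) (by norm_num) (by norm_num) (by norm_num) (by norm_num) (by norm_num) (by norm_num)
    (by norm_num) (by norm_num) (by norm_num) (by norm_num) hβ (by norm_num)
    (lsco78_capPlane_on_cell_of hVB (by norm_num) (by norm_num) (by norm_num))
    (fun s hs => lsco_n1_law8_of hK8 h472 h428 s ⟨hs.1.trans' (by norm_num), hs.2.trans (by norm_num)⟩)
    (fun s hs U hU => lsco_dilute14_floor_right (n₁ := 1 / 5) (by norm_num) (by norm_num) s hs U (by linarith [hU.1]))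
    (lsco_diluteCap_1o5 (by norm_num))
    (lsco_hotCap_n1_b2_j300793_on_cell hC1 (by norm_num) (by norm_num) (by norm_num))
    ?_ ?_ hs hU hω₁ (meanEnergy_gcInteractionTT'_zero_field_eq_sub 1 s U μ) hρ₁ hρ₂
  · intro s hs; obtain ⟨h1, h2⟩ := hs; push_cast; norm_num; nlinarith [h1, h2]
  · intro s hs; obtain ⟨h1, h2⟩ := hs; push_cast; norm_num; nlinarith [h1, h2]

/-- **`Δμ ≥ t/10` for every `β ≥ 16`** on `t′ ∈ [−1/4, −1/5] × U ∈ [8, 81/10]` (`β₀ = 15.47`, `g = 27/2560`; parents: `β ≥ 30`): the chemical potentials carrying a `≤ 1/5`-filled and a `≥ 1`-filled equilibrium state differ by at least `1/10`. [cite: Israel1979, Thm. I.2.4] [cite: Griffiths1966, §II] [cite: PoulinHastings2011, eqs. (3)–(8)] -/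
theorem lsco78_chemPot_gap_1o10_le_1o5_ge_one_beta16_tpm1o4_1o5 (hVB : cert_obx32x4tpm1o4D1200_openbox_32x4_N112_planes)
    (hK8 : cert_laBoxE_K2diag_GU8n1tpm3o10_j299783_up)
    (h472 : cert_r472_pb2_tl_upper_n1_U8) (h428 : cert_r428_hubSQ_hanK7R6_U8_r5_e4_so4blk)
    (hC1 : cert_feC1tt_stair221_tpm1o4_b2_j300793)
    {s : ℝ} (hs : s ∈ Icc (-1 / 4 : ℝ) (-1 / 5)) {U : ℝ} (hU : U ∈ Icc (8 : ℝ) (81 / 10))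
    {β : ℝ} (hβ : (16 : ℝ) ≤ β) {μ₁ μ₂ : ℝ} {ω₁ ω₂ : InfVolFermionState 2}
    (hω₁ : ω₁.IsVarEquilibrium β (gcInteractionTT' 1 s U μ₁ 0) 1) (hρ₁ : ω₁.density ≤ 1 / 5)
    (hω₂ : ω₂.IsVarEquilibrium β (gcInteractionTT' 1 s U μ₂ 0) 1) (hρ₂ : 1 ≤ ω₂.density) :
    (1 : ℝ) / 10 ≤ μ₂ - μ₁ := by
  have k := psGCT_gap_above_column_hotAnchor 1 (s₁ := -1 / 4) (s₂ := -1 / 5) (U₂ := 8) (U₃ := 81 / 10)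
    (n₁ := 1 / 5) (n₂ := 1) (a := 5 / 32) (b := 27 / 32) (β₀ := 16) (βh₁ := 0) (βh₂ := 2)
    (π₁ := 0.666) (π₂ := 3994878420865131 / 2251799813685248) (g := 27 / 2560)
    (by norm_num) (by norm_num) (by norm_num) (by norm_num) (by norm_num) (by norm_num) (by norm_num) (by norm_num)
    (by norm_num) (by norm_num) (by norm_num) (by norm_num) (by norm_num)
    (lsco78_capPlane_on_cell_of hVB (by norm_num) (by norm_num) (by norm_num))
    (fun s hs => lsco_n1_law8_of hK8 h472 h428 s ⟨hs.1.trans' (by norm_num), hs.2.trans (by norm_num)⟩)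
    (fun s hs U hU => lsco_dilute14_floor_right (n₁ := 1 / 5) (by norm_num) (by norm_num) s hs U (by linarith [hU.1]))
    (lsco_diluteCap_1o5 (by norm_num))
    (lsco_hotCap_n1_b2_j300793_on_cell hC1 (by norm_num) (by norm_num) (by norm_num))
    ?_ ?_ hs hU hβ hω₁ (meanEnergy_gcInteractionTT'_zero_field_eq_sub 1 s U μ₁) hω₂
    (meanEnergy_gcInteractionTT'_zero_field_eq_sub 1 s U μ₂) hρ₁ hρ₂
  · linarith
  · intro s hs; obtain ⟨h1, h2⟩ := hs; push_cast; norm_num; nlinarith [h1, h2]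
  · intro s hs; obtain ⟨h1, h2⟩ := hs; push_cast; norm_num; nlinarith [h1, h2]

/-- **`Δμ ≥ t/5` for every `β ≥ 23`** on `t′ ∈ [−1/4, −1/5] × U ∈ [8, 81/10]` (`β₀ = 22.34`, `g = 27/1280`; parents: `β ≥ 53` untyped). [cite: Israel1979, Thm. I.2.4] [cite: Griffiths1966, §II] [cite: PoulinHastings2011, eqs. (3)–(8)] -/
theorem lsco78_chemPot_gap_1o5_le_1o5_ge_one_beta23_tpm1o4_1o5 (hVB : cert_obx32x4tpm1o4D1200_openbox_32x4_N112_planes)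
    (hK8 : cert_laBoxE_K2diag_GU8n1tpm3o10_j299783_up)
    (h472 : cert_r472_pb2_tl_upper_n1_U8) (h428 : cert_r428_hubSQ_hanK7R6_U8_r5_e4_so4blk)
    (hC1 : cert_feC1tt_stair221_tpm1o4_b2_j300793)
    {s : ℝ} (hs : s ∈ Icc (-1 / 4 : ℝ) (-1 / 5)) {U : ℝ} (hU : U ∈ Icc (8 : ℝ) (81 / 10))
    {β : ℝ} (hβ : (23 : ℝ) ≤ β) {μ₁ μ₂ : ℝ} {ω₁ ω₂ : InfVolFermionState 2}
    (hω₁ : ω₁.IsVarEquilibrium β (gcInteractionTT' 1 s U μ₁ 0) 1) (hρ₁ : ω₁.density ≤ 1 / 5)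
    (hω₂ : ω₂.IsVarEquilibrium β (gcInteractionTT' 1 s U μ₂ 0) 1) (hρ₂ : 1 ≤ ω₂.density) :
    (1 : ℝ) / 5 ≤ μ₂ - μ₁ := by
  have k := psGCT_gap_above_column_hotAnchor 1 (s₁ := -1 / 4) (s₂ := -1 / 5) (U₂ := 8) (U₃ := 81 / 10)
    (n₁ := 1 / 5) (n₂ := 1) (a := 5 / 32) (b := 27 / 32) (β₀ := 23) (βh₁ := 0) (βh₂ := 2)
    (π₁ := 0.666) (π₂ := 3994878420865131 / 2251799813685248) (g := 27 / 1280)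
    (by norm_num) (by norm_num) (by norm_num) (by norm_num) (by norm_num) (by norm_num) (by norm_num) (by norm_num)
    (by norm_num) (by norm_num) (by norm_num) (by norm_num) (by norm_num)
    (lsco78_capPlane_on_cell_of hVB (by norm_num) (by norm_num) (by norm_num))
    (fun s hs => lsco_n1_law8_of hK8 h472 h428 s ⟨hs.1.trans' (by norm_num), hs.2.trans (by norm_num)⟩)
    (fun s hs U hU => lsco_dilute14_floor_right (n₁ := 1 / 5) (by norm_num) (by norm_num) s hs U (by linarith [hU.1]))
    (lsco_diluteCap_1o5 (by norm_num))
    (lsco_hotCap_n1_b2_j300793_on_cell hC1 (by norm_num) (by norm_num) (by norm_num))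
    ?_ ?_ hs hU hβ hω₁ (meanEnergy_gcInteractionTT'_zero_field_eq_sub 1 s U μ₁) hω₂
    (meanEnergy_gcInteractionTT'_zero_field_eq_sub 1 s U μ₂) hρ₁ hρ₂
  · linarith
  · intro s hs; obtain ⟨h1, h2⟩ := hs; push_cast; norm_num; nlinarith [h1, h2]
  · intro s hs; obtain ⟨h1, h2⟩ := hs; push_cast; norm_num; nlinarith [h1, h2]

/-- **`Δμ ≥ t/4` for every `β ≥ 29`** on `t′ ∈ [−1/4, −1/5] × U ∈ [8, 81/10]` (`β₀ = 28.71`, `g = 27/1024`; the `T = 0` gap on the cell is `33/100`, p664356). [cite: Israel1979, Thm. I.2.4] [cite: Griffiths1966, §II] [cite: PoulinHastings2011, eqs. (3)–(8)] -/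
theorem lsco78_chemPot_gap_1o4_le_1o5_ge_one_beta29_tpm1o4_1o5 (hVB : cert_obx32x4tpm1o4D1200_openbox_32x4_N112_planes)
    (hK8 : cert_laBoxE_K2diag_GU8n1tpm3o10_j299783_up)
    (h472 : cert_r472_pb2_tl_upper_n1_U8) (h428 : cert_r428_hubSQ_hanK7R6_U8_r5_e4_so4blk)
    (hC1 : cert_feC1tt_stair221_tpm1o4_b2_j300793)
    {s : ℝ} (hs : s ∈ Icc (-1 / 4 : ℝ) (-1 / 5)) {U : ℝ} (hU : U ∈ Icc (8 : ℝ) (81 / 10))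
    {β : ℝ} (hβ : (29 : ℝ) ≤ β) {μ₁ μ₂ : ℝ} {ω₁ ω₂ : InfVolFermionState 2}
    (hω₁ : ω₁.IsVarEquilibrium β (gcInteractionTT' 1 s U μ₁ 0) 1) (hρ₁ : ω₁.density ≤ 1 / 5)
    (hω₂ : ω₂.IsVarEquilibrium β (gcInteractionTT' 1 s U μ₂ 0) 1) (hρ₂ : 1 ≤ ω₂.density) :
    (1 : ℝ) / 4 ≤ μ₂ - μ₁ := by
  have k := psGCT_gap_above_column_hotAnchor 1 (s₁ := -1 / 4) (s₂ := -1 / 5) (U₂ := 8) (U₃ := 81 / 10)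
    (n₁ := 1 / 5) (n₂ := 1) (a := 5 / 32) (b := 27 / 32) (β₀ := 29) (βh₁ := 0) (βh₂ := 2)
    (π₁ := 0.666) (π₂ := 3994878420865131 / 2251799813685248) (g := 27 / 1024)
    (by norm_num) (by norm_num) (by norm_num) (by norm_num) (by norm_num) (by norm_num) (by norm_num) (by norm_num)
    (by norm_num) (by norm_num) (by norm_num) (by norm_num) (by norm_num)
    (lsco78_capPlane_on_cell_of hVB (by norm_num) (by norm_num) (by norm_num))
    (fun s hs => lsco_n1_law8_of hK8 h472 h428 s ⟨hs.1.trans' (by norm_num), hs.2.trans (by norm_num)⟩)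
    (fun s hs U hU => lsco_dilute14_floor_right (n₁ := 1 / 5) (by norm_num) (by norm_num) s hs U (by linarith [hU.1]))
    (lsco_diluteCap_1o5 (by norm_num))
    (lsco_hotCap_n1_b2_j300793_on_cell hC1 (by norm_num) (by norm_num) (by norm_num))
    ?_ ?_ hs hU hβ hω₁ (meanEnergy_gcInteractionTT'_zero_field_eq_sub 1 s U μ₁) hω₂
    (meanEnergy_gcInteractionTT'_zero_field_eq_sub 1 s U μ₂) hρ₁ hρ₂
  · linarith
  · intro s hs; obtain ⟨h1, h2⟩ := hs; push_cast; norm_num; nlinarith [h1, h2]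
  · intro s hs; obtain ⟨h1, h2⟩ := hs; push_cast; norm_num; nlinarith [h1, h2]

end Summit.Ventures.CertifiedManyBodySolver.Downfold
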